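import Literature.NumberTheory.Automorphic.CuspidalContragredientArch
import Literature.NumberTheory.Automorphic.AutomorphicRepsGL
import HarnessLib

/-!
# The contragredient on `GL_n(𝔸_K)`: automorphic forms, stable subspaces and cusp forms under `φ ↦ φ ∘ τ`

Topic `NumberTheory/Automorphic`. Proofs-only support file (theorems, no definitions, no named
facts), third of the series `CuspidalContragredient{Involution, Arch, Forms, Hecke, Proofs}`
discharging `CuspidalAutomorphicRepData.exists_contragredient_satake` (`CuspidalContragredient`),
`τ(g) = w₀ ᵗg⁻¹ w₀` on `GL_n(𝔸_K)` (Cogdell 2004, §2: `φ̃(g) = φ(g^ι) = φ(w_n g^ι) ∈ V_{π̃}`).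

* Precomposition `φ ↦ φ ∘ τ` (Mathlib `LinearMap.funLeft`) is a linear involution of the functions on
  `GL_n(𝔸_K)` intertwining `r(h)` with `r(τ h)`; `W ↦ W ∘ τ` (`Submodule.map`) is an involutive,
  strictly monotone map of subspaces.
* `IsAutomorphicForm.funLeft_…` — `φ ∘ τ` is an automorphic form for the `GL_n` datum whenever `φ`
  is (Borel–Jacquet 1979, 4.2: `τ` preserves `GL_n(K)`, permutes the levels, preserves the height,
  and the archimedean conditions by `CuspidalContragredientArch`);
  `IsStableSubmodule.map_funLeft_…`, `irreducible_map_funLeft_…` (BJ 4.3, 4.6).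
* `CuspConditionGL.funLeft_…` — the constant term of `φ ∘ τ` along `P_k` is that of `φ` along
  `P_{n-k}`: `τ(1 + X) = 1 + X'`, `X'_{ij} = -X_{rev j, rev i}`, an additive homeomorphism
  `𝔫_k(𝔸_K) ≃ 𝔫_{n-k}(𝔸_K)` mapping `𝔫_k(K)` onto `𝔫_{n-k}(K)`, Haar measures to Haar measures and
  fundamental domains to fundamental domains (the change of variables of
  `AutomorphicGaloisConj.ConstantTermVanishes.comp_gal_smul`); hence `IsCuspFormGL.funLeft_…` and
  the stability of `cuspFormsGL` (BJ 4.4).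

## References

* A. Borel, H. Jacquet, *Automorphic forms and automorphic representations*, PSPM 33.1 (1979),
  §4.2–4.6. [BorelJacquetCorvallis1979]
* J. W. Cogdell, *Analytic theory of L-functions for GL_n*, in: An Introduction to the Langlands
  Program, Birkhäuser 2004, §2. [CogdellAnalyticTheory2004]
-/

noncomputable section

open scoped MatrixGroups Matrix NNReal Classical ContDiff
open NumberField IsDedekindDomain

namespace Literature.NumberTheory.Automorphic

open GaloisRepresentations (glTransposeInv coe_glTransposeInv_apply)

/-! ### Automorphic forms and stable subspaces under `φ ↦ φ ∘ τ` -/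

section Forms

-- Mathlib idiom (Mathlib/Algebra/Lie/OfAssociative.lean), as in `RealMatrixGroups`, `AutomorphicForms`.
attribute [local instance 100] LieRing.ofAssociativeRing

variable {n : ℕ} {K : Type} [Field K] [NumberField K] {hcpt : isCompact_glFiniteIntegralLevel n K}

local notation "𝕂∞" => mixedEmbedding.mixedSpace K
local notation "𝒟" => AutomorphyDatum.gl n K hcpt
local notation "τ∞[" g "]" => weylLong n (mixedEmbedding.mixedSpace K) *
  glTransposeInv (Fin n) (mixedEmbedding.mixedSpace K) g * weylLong n (mixedEmbedding.mixedSpace K)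
local notation "τ𝔸[" g "]" => weylLong n (AdeleRing (𝓞 K) K) *
  glTransposeInv (Fin n) (AdeleRing (𝓞 K) K) g * weylLong n (AdeleRing (𝓞 K) K)
set_option quotPrecheck false in
local notation "τ𝔸⋆" => LinearMap.funLeft ℂ ℂ (m := (AdelicGroupData.gl n K).Adelic)
  (n := (AdelicGroupData.gl n K).Adelic) fun g => τ𝔸[g]

/-- `(φ ∘ τ) g = φ (τ g)` (definitional). [folklore] -/
theorem funLeft_weylLong_mul_glTransposeInv_mul_weylLong_apply
    (φ : (AdelicGroupData.gl n K).Adelic → ℂ) (g : (AdelicGroupData.gl n K).Adelic) :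
    (τ𝔸⋆ φ) g = φ (τ𝔸[g]) :=
  rfl

/-- Precomposition with the involution `τ` is an involution of the function space. [folklore] -/
theorem funLeft_weylLong_mul_glTransposeInv_mul_weylLong_involutive
    (φ : (AdelicGroupData.gl n K).Adelic → ℂ) : τ𝔸⋆ (τ𝔸⋆ φ) = φ := by
  funext g
  rw [LinearMap.funLeft_apply, LinearMap.funLeft_apply,
    weylLong_mul_glTransposeInv_mul_weylLong_involutive]

/-- Right translation of `φ ∘ τ`: `r(h) (φ ∘ τ) = (r(τ h) φ) ∘ τ`. [folklore] -/
theorem rightTranslation_funLeft_weylLong_mul_glTransposeInv_mul_weylLong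
    (h : (AdelicGroupData.gl n K).Adelic) (φ : (AdelicGroupData.gl n K).Adelic → ℂ) :
    rightTranslation (AdelicGroupData.gl n K) h (τ𝔸⋆ φ) =
      τ𝔸⋆ (rightTranslation (AdelicGroupData.gl n K) (τ𝔸[h]) φ) := by
  funext g
  rw [rightTranslation_apply, LinearMap.funLeft_apply, LinearMap.funLeft_apply,
    rightTranslation_apply, weylLong_mul_glTransposeInv_mul_weylLong_mul_adelic]
  rfl

/-- `(W ∘ τ) ∘ τ = W` for a subspace `W` of functions on `GL_n(𝔸_K)`. [folklore] -/
theorem map_funLeft_map_funLeft_weylLong_mul_glTransposeInv_mul_weylLong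
    (W : Submodule ℂ ((AdelicGroupData.gl n K).Adelic → ℂ)) : (W.map τ𝔸⋆).map τ𝔸⋆ = W := by
  rw [← Submodule.map_comp]
  convert Submodule.map_id W
  exact LinearMap.ext funLeft_weylLong_mul_glTransposeInv_mul_weylLong_involutive

/-- Membership in `W ∘ τ`: `ψ ∈ W ∘ τ ↔ ψ ∘ τ ∈ W`. [folklore] -/
theorem mem_map_funLeft_weylLong_mul_glTransposeInv_mul_weylLong_iff
    (W : Submodule ℂ ((AdelicGroupData.gl n K).Adelic → ℂ)) (ψ : (AdelicGroupData.gl n K).Adelic → ℂ) :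
    ψ ∈ W.map τ𝔸⋆ ↔ τ𝔸⋆ ψ ∈ W := by
  constructor
  · rintro ⟨φ, hφ, rfl⟩
    rwa [funLeft_weylLong_mul_glTransposeInv_mul_weylLong_involutive]
  · intro h
    exact ⟨_, h, funLeft_weylLong_mul_glTransposeInv_mul_weylLong_involutive ψ⟩

/-- `W ∘ τ ≤ V ↔ W ≤ V ∘ τ`. [folklore] -/
theorem map_funLeft_weylLong_mul_glTransposeInv_mul_weylLong_le_iff
    (W V : Submodule ℂ ((AdelicGroupData.gl n K).Adelic → ℂ)) : W.map τ𝔸⋆ ≤ V ↔ W ≤ V.map τ𝔸⋆ := by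
  constructor
  · intro h φ hφ
    rw [mem_map_funLeft_weylLong_mul_glTransposeInv_mul_weylLong_iff]
    exact h (Submodule.mem_map_of_mem hφ)
  · intro h ψ hψ
    rw [mem_map_funLeft_weylLong_mul_glTransposeInv_mul_weylLong_iff] at hψ
    have := h hψ
    rwa [mem_map_funLeft_weylLong_mul_glTransposeInv_mul_weylLong_iff,
      funLeft_weylLong_mul_glTransposeInv_mul_weylLong_involutive] at this

/-- `W ↦ W ∘ τ` is strictly monotone. [folklore] -/
theorem map_funLeft_weylLong_mul_glTransposeInv_mul_weylLong_lt
    {W V : Submodule ℂ ((AdelicGroupData.gl n K).Adelic → ℂ)} (h : W < V) : W.map τ𝔸⋆ < V.map τ𝔸⋆ :=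
  lt_of_le_of_ne (Submodule.map_mono h.le) fun he => h.ne (by
    rw [← map_funLeft_map_funLeft_weylLong_mul_glTransposeInv_mul_weylLong W, he,
      map_funLeft_map_funLeft_weylLong_mul_glTransposeInv_mul_weylLong])

/-- Left `GL_n(K)`-invariance is preserved by `φ ↦ φ ∘ τ` (`τ(GL_n(K)) = GL_n(K)`).
Borel–Jacquet 1979, §4.2(a). [folklore] -/
theorem IsLeftInvariant.funLeft_weylLong_mul_glTransposeInv_mul_weylLong
    {φ : (AdelicGroupData.gl n K).Adelic → ℂ} (hφ : IsLeftInvariant (AdelicGroupData.gl n K) φ) :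
    IsLeftInvariant (AdelicGroupData.gl n K) (τ𝔸⋆ φ) := fun γ hγ g => by
  rw [LinearMap.funLeft_apply, LinearMap.funLeft_apply,
    weylLong_mul_glTransposeInv_mul_weylLong_mul_adelic]
  exact hφ _ (weylLong_mul_glTransposeInv_mul_weylLong_mem_arithmeticSubgroup hγ) _

/-- Moderate growth is preserved by `φ ↦ φ ∘ τ` (the height is `τ`-invariant).
Borel–Jacquet 1979, §4.2(d). [folklore] -/
theorem HasModerateGrowth.funLeft_weylLong_mul_glTransposeInv_mul_weylLong
    {φ : (AdelicGroupData.gl n K).Adelic → ℂ} (hφ : HasModerateGrowth (𝒟) φ) :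
    HasModerateGrowth (𝒟) (τ𝔸⋆ φ) := by
  obtain ⟨C, r, h⟩ := hφ
  refine ⟨C, r, fun g => ?_⟩
  have := h (τ𝔸[g])
  rwa [AutomorphyDatum.gl_height, adelicHeightGL_weylLong_mul_glTransposeInv_mul_weylLong] at this

/-- **`φ ∘ τ` is an automorphic form for every automorphic form `φ` on `GL_n(𝔸_K)`**: left
invariance, levels (`τ` permutes the levels), moderate growth, archimedean smoothness, `K_∞`- and
`Z(𝔤)`-finiteness are all transported along the automorphism `τ`. Borel–Jacquet 1979, 4.2;
Cogdell 2004, §2 (`φ̃(g) = φ(w_n ᵗg⁻¹) ∈ V_{π̃}`). [folklore] -/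
theorem IsAutomorphicForm.funLeft_weylLong_mul_glTransposeInv_mul_weylLong
    {φ : (AdelicGroupData.gl n K).Adelic → ℂ} (hφ : IsAutomorphicForm (𝒟) φ) :
    IsAutomorphicForm (𝒟) (τ𝔸⋆ φ) := by
  obtain ⟨θ, hθ⟩ := exists_lieHom_neg_weylLong_transpose (hcpt := hcpt)
  obtain ⟨U, hU, hUφ⟩ := hφ.exists_level
  obtain ⟨U', hU', hU'U⟩ := exists_mem_finiteLevelsGL_iff_weylLong_mul_glTransposeInv_mul_weylLong_mem hU
  exact
    { leftInvariant := hφ.leftInvariant.funLeft_weylLong_mul_glTransposeInv_mul_weylLong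
      exists_level := ⟨U', hU', fun u hu g => by
        rw [LinearMap.funLeft_apply, LinearMap.funLeft_apply,
          weylLong_mul_glTransposeInv_mul_weylLong_mul_adelic]
        exact hUφ _ ((hU'U u).mp hu) _⟩
      archSmooth := hφ.archSmooth.comp_weylLong_mul_glTransposeInv_mul_weylLong θ hθ
      kFinite := hφ.kFinite.comp_weylLong_mul_glTransposeInv_mul_weylLong
      zFinite := hφ.zFinite.comp_weylLong_mul_glTransposeInv_mul_weylLong θ hθ
      moderateGrowth := hφ.moderateGrowth.funLeft_weylLong_mul_glTransposeInv_mul_weylLong }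

/-- The space of automorphic forms on `GL_n(𝔸_K)` is stable under `φ ↦ φ ∘ τ`. [folklore] -/
theorem map_funLeft_weylLong_mul_glTransposeInv_mul_weylLong_automorphicForms_le :
    (automorphicForms (𝒟)).map τ𝔸⋆ ≤ automorphicForms (𝒟) := by
  rw [automorphicForms, Submodule.map_span, Submodule.span_le]
  rintro _ ⟨φ, hφ, rfl⟩
  exact (IsAutomorphicForm.funLeft_weylLong_mul_glTransposeInv_mul_weylLong hφ).mem_automorphicForms

/-- `τ (1, k) = (1, τ k)` for `k ∈ K_∞`: the image of `K_∞` in `GL_n(𝔸_K)` is `τ`-stable. [folklore] -/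
theorem weylLong_mul_glTransposeInv_mul_weylLong_ofK (k : (𝒟).arch.maximalCompact) :
    τ𝔸[(𝒟).ofK k] = (𝒟).ofK ⟨τ∞[(k : GL (Fin n) 𝕂∞)],
      weylLong_mul_glTransposeInv_mul_weylLong_mem_Kinf
        (AutomorphyDatum.gl_arch_maximalCompact n K hcpt ▸ k.2)⟩ := by
  rw [AutomorphyDatum.ofK_apply, AutomorphyDatum.ofK_apply, AutomorphyDatum.gl_ofArch_apply,
    AutomorphyDatum.gl_ofArch_apply, weylLong_mul_glTransposeInv_mul_weylLong_ofInfinite]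
  rfl

/-- **`W ∘ τ` is a `(𝔤, K_∞) × G(𝔸_f)`-stable subspace of automorphic forms whenever `W` is**
(right translations and Lie derivatives are intertwined with their `τ`-, resp. `θ`-, images).
Borel–Jacquet 1979, 4.3 and 4.6; Cogdell 2004, §2. [folklore] -/
theorem IsStableSubmodule.map_funLeft_weylLong_mul_glTransposeInv_mul_weylLong
    {W : Submodule ℂ ((AdelicGroupData.gl n K).Adelic → ℂ)} (hW : IsStableSubmodule (𝒟) W) :
    IsStableSubmodule (𝒟) (W.map τ𝔸⋆) := by
  obtain ⟨θ, hθ⟩ := exists_lieHom_neg_weylLong_transpose (hcpt := hcpt)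
  refine ⟨(Submodule.map_mono hW.le_automorphicForms).trans
    map_funLeft_weylLong_mul_glTransposeInv_mul_weylLong_automorphicForms_le, ?_, ?_, ?_⟩
  · rintro h hh _ ⟨φ, hφ, rfl⟩
    rw [Submodule.mem_comap, rightTranslation_funLeft_weylLong_mul_glTransposeInv_mul_weylLong]
    refine Submodule.mem_map_of_mem (hW.finite_stable _ ?_ hφ)
    rw [AutomorphyDatum.gl_finiteAdelic] at hh ⊢
    exact weylLong_mul_glTransposeInv_mul_weylLong_mem_range_ofFinite hh
  · rintro k _ ⟨φ, hφ, rfl⟩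
    rw [Submodule.mem_comap, rightTranslation_funLeft_weylLong_mul_glTransposeInv_mul_weylLong,
      weylLong_mul_glTransposeInv_mul_weylLong_ofK]
    exact Submodule.mem_map_of_mem (hW.k_stable _ hφ)
  · rintro X _ ⟨φ, hφ, rfl⟩
    have h := lieDeriv_comp_weylLong_mul_glTransposeInv_mul_weylLong θ hθ X φ (hcpt := hcpt)
    change lieDeriv (𝒟).ofArch X (τ𝔸⋆ φ) ∈ _
    have h' : lieDeriv (𝒟).ofArch X (τ𝔸⋆ φ) = τ𝔸⋆ (lieDeriv (𝒟).ofArch (θ X) φ) := h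
    rw [h']
    exact Submodule.mem_map_of_mem (hW.lie_stable _ _ hφ)

/-- **Irreducibility is preserved**: if no stable subspace lies strictly between `W'` and `W`, then
none lies strictly between `W' ∘ τ` and `W ∘ τ` (`W ↦ W ∘ τ` is an involutive order isomorphism
of stable subspaces). Borel–Jacquet 1979, 4.6. [folklore] -/
theorem irreducible_map_funLeft_weylLong_mul_glTransposeInv_mul_weylLong
    {W W' : Submodule ℂ ((AdelicGroupData.gl n K).Adelic → ℂ)}
    (hirr : ∀ W'' : Submodule ℂ ((AdelicGroupData.gl n K).Adelic → ℂ), W' ≤ W'' → W'' ≤ W →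
      IsStableSubmodule (𝒟) W'' → W'' = W' ∨ W'' = W)
    (W'' : Submodule ℂ ((AdelicGroupData.gl n K).Adelic → ℂ)) (h₁ : W'.map τ𝔸⋆ ≤ W'')
    (h₂ : W'' ≤ W.map τ𝔸⋆) (hst : IsStableSubmodule (𝒟) W'') :
    W'' = W'.map τ𝔸⋆ ∨ W'' = W.map τ𝔸⋆ := by
  have h₁' : W' ≤ W''.map τ𝔸⋆ :=
    (map_funLeft_weylLong_mul_glTransposeInv_mul_weylLong_le_iff _ _).mp h₁
  have h₂' : W''.map τ𝔸⋆ ≤ W := by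
    rw [map_funLeft_weylLong_mul_glTransposeInv_mul_weylLong_le_iff]
    exact h₂
  rcases hirr _ h₁' h₂' (hst.map_funLeft_weylLong_mul_glTransposeInv_mul_weylLong) with h | h
  · left
    rw [← map_funLeft_map_funLeft_weylLong_mul_glTransposeInv_mul_weylLong W'', h]
  · right
    rw [← map_funLeft_map_funLeft_weylLong_mul_glTransposeInv_mul_weylLong W'', h]

end Forms

/-! ### Cusp forms under `φ ↦ φ ∘ τ`: the constant term along `P_k` becomes that along `P_{n-k}` -/

section Cusp

open MeasureTheory

variable {n : ℕ} {K : Type} [Field K] [NumberField K] {hcpt : isCompact_glFiniteIntegralLevel n K}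

local notation "𝒟" => AutomorphyDatum.gl n K hcpt
local notation "τ𝔸[" g "]" => weylLong n (AdeleRing (𝓞 K) K) *
  glTransposeInv (Fin n) (AdeleRing (𝓞 K) K) g * weylLong n (AdeleRing (𝓞 K) K)
set_option quotPrecheck false in
local notation "τ𝔸⋆" => LinearMap.funLeft ℂ ℂ (m := (AdelicGroupData.gl n K).Adelic)
  (n := (AdelicGroupData.gl n K).Adelic) fun g => τ𝔸[g]

/-- The entries `X_{rev j, rev i}` of a block-nilpotent `X ∈ 𝔫_k` vanish unless `i < n - k ≤ j`:
the reflected, transposed block of type `k` is the block of type `n - k`. [folklore] -/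
theorem neg_apply_rev_rev_mem_blockNilpotent {R : Type*} [CommRing R] {k : ℕ}
    (X : blockNilpotent n k R) :
    (Matrix.of fun i j : Fin n => -(X : Matrix (Fin n) (Fin n) R) j.rev i.rev) ∈
      blockNilpotent n (n - k) R := by
  intro i j hij
  rw [Matrix.of_apply, neg_ne_zero] at hij
  have h := X.2 _ _ hij
  simp only [Fin.val_rev] at h
  omega

/-- Conversely the reflected, transposed block of type `n - k` is the block of type `k`. [folklore] -/
theorem neg_apply_rev_rev_mem_blockNilpotent' {R : Type*} [CommRing R] {k : ℕ}
    (Y : blockNilpotent n (n - k) R) :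
    (Matrix.of fun i j : Fin n => -(Y : Matrix (Fin n) (Fin n) R) j.rev i.rev) ∈
      blockNilpotent n k R := by
  intro i j hij
  rw [Matrix.of_apply, neg_ne_zero] at hij
  have h := Y.2 _ _ hij
  simp only [Fin.val_rev] at h
  omega

/-- **`τ` on unipotent elements**: `τ(1 + X) = w₀ ᵗ(1 - X) w₀ = 1 + X'` with
`X'_{ij} = -X_{rev j, rev i}`, an element of `N_{n-k}` for `X ∈ 𝔫_k`. [folklore] -/
theorem weylLong_mul_glTransposeInv_mul_weylLong_glUnipotent {k : ℕ}
    (X : blockNilpotent n k (AdeleRing (𝓞 K) K)) :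
    τ𝔸[glUnipotent n k K (Multiplicative.ofAdd X)] =
      glUnipotent n (n - k) K (Multiplicative.ofAdd
        ⟨Matrix.of fun i j : Fin n => -(X : Matrix (Fin n) (Fin n) (AdeleRing (𝓞 K) K)) j.rev i.rev,
          neg_apply_rev_rev_mem_blockNilpotent X⟩) := by
  refine Matrix.GeneralLinearGroup.ext fun i j => ?_
  have hinv : (((glUnipotent n k K (Multiplicative.ofAdd X))⁻¹ : GL (Fin n) (AdeleRing (𝓞 K) K)) :
      Matrix (Fin n) (Fin n) (AdeleRing (𝓞 K) K)) = 1 - (X : Matrix (Fin n) (Fin n) (AdeleRing (𝓞 K) K)) :=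
    rfl
  rw [coe_weylLong_mul_glTransposeInv_mul_weylLong_apply, hinv, glUnipotent_apply, coe_unipotentOfBlock,
    toAdd_ofAdd, Matrix.sub_apply, Matrix.add_apply, Matrix.one_apply, Matrix.one_apply]
  change _ = _ + (Matrix.of fun i j : Fin n => -(X : Matrix (Fin n) (Fin n) (AdeleRing (𝓞 K) K)) j.rev i.rev) i j
  rw [Matrix.of_apply, sub_eq_add_neg]
  by_cases hij : i = j
  · subst hij
    rw [if_pos rfl, if_pos rfl]
  · rw [if_neg hij, if_neg (fun h' => hij (Fin.rev_injective h').symm)]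

/-- **The cusp condition along `P_k` for `φ ∘ τ` is the cusp condition along `P_{n-k}` for `φ`.**
`τ` maps `N_k(𝔸_K)` onto `N_{n-k}(𝔸_K)` by the additive homeomorphism `X ↦ X'`,
`X'_{ij} = -X_{rev j, rev i}`, of `𝔫_k(𝔸_K)` onto `𝔫_{n-k}(𝔸_K)`, which maps `𝔫_k(K)` onto
`𝔫_{n-k}(K)`, Haar measures to Haar measures and fundamental domains to fundamental domains; so
`∫_{N_k(K)\N_k(𝔸)} φ(τ(u g)) du = ∫_{N_{n-k}(K)\N_{n-k}(𝔸)} φ(u' τ(g)) du' = 0`.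
(Borel–Jacquet 1979, 4.4; the parabolics `P_k` and `ᵗP_k⁻¹` are exchanged by `w₀`.) [folklore] -/
theorem CuspConditionGL.funLeft_weylLong_mul_glTransposeInv_mul_weylLong
    {φ : (AdelicGroupData.gl n K).Adelic → ℂ} {k : ℕ} (hφ : CuspConditionGL n K φ (n - k)) :
    CuspConditionGL n K (τ𝔸⋆ φ) k := by
  intro ν _ 𝓕 h𝓕 g
  -- the change of variables `T : 𝔫_k(𝔸) ≃+ 𝔫_{n-k}(𝔸)`, `(T X)_{ij} = -X_{rev j, rev i}`
  let T : blockNilpotent n k (AdeleRing (𝓞 K) K) ≃+ blockNilpotent n (n - k) (AdeleRing (𝓞 K) K) :=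
    { toFun := fun X => ⟨Matrix.of fun i j : Fin n =>
          -(X : Matrix (Fin n) (Fin n) (AdeleRing (𝓞 K) K)) j.rev i.rev,
        neg_apply_rev_rev_mem_blockNilpotent X⟩
      invFun := fun Y => ⟨Matrix.of fun i j : Fin n =>
          -(Y : Matrix (Fin n) (Fin n) (AdeleRing (𝓞 K) K)) j.rev i.rev,
        neg_apply_rev_rev_mem_blockNilpotent' Y⟩
      left_inv := fun X => Subtype.ext (Matrix.ext fun i j => by simp)
      right_inv := fun Y => Subtype.ext (Matrix.ext fun i j => by simp)
      map_add' := fun X Y => Subtype.ext (Matrix.ext fun i j => by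
        change -((X : Matrix (Fin n) (Fin n) (AdeleRing (𝓞 K) K)) + Y) j.rev i.rev =
          -(X : Matrix (Fin n) (Fin n) (AdeleRing (𝓞 K) K)) j.rev i.rev +
            -(Y : Matrix (Fin n) (Fin n) (AdeleRing (𝓞 K) K)) j.rev i.rev
        rw [Matrix.add_apply, neg_add]) }
  have hT : ∀ X, (T X : blockNilpotent n (n - k) (AdeleRing (𝓞 K) K)) =
      ⟨Matrix.of fun i j : Fin n => -(X : Matrix (Fin n) (Fin n) (AdeleRing (𝓞 K) K)) j.rev i.rev,
        neg_apply_rev_rev_mem_blockNilpotent X⟩ := fun X => rfl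
  have hTc : Continuous T := by
    refine Continuous.subtype_mk (continuous_matrix fun i j => ?_) _
    exact ((continuous_subtype_val.matrix_elem j.rev i.rev)).neg
  have hTsc : Continuous T.symm := by
    refine Continuous.subtype_mk (continuous_matrix fun i j => ?_) _
    exact ((continuous_subtype_val.matrix_elem j.rev i.rev)).neg
  let Th : blockNilpotent n k (AdeleRing (𝓞 K) K) ≃ₜ blockNilpotent n (n - k) (AdeleRing (𝓞 K) K) :=
    { T.toEquiv with continuous_toFun := hTc, continuous_invFun := hTsc }
  let Tm : blockNilpotent n k (AdeleRing (𝓞 K) K) ≃ᵐ blockNilpotent n (n - k) (AdeleRing (𝓞 K) K) :=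
    Th.toMeasurableEquiv
  have hTm : ∀ X, Tm X = T X := fun X => rfl
  haveI : (Measure.map Tm ν).IsAddHaarMeasure := AddEquiv.isAddHaarMeasure_map ν T hTc hTsc
  have hpres : MeasurePreserving Tm ν (Measure.map Tm ν) := ⟨Tm.measurable, rfl⟩
  -- the lattice `𝔫_k(K)` is mapped onto `𝔫_{n-k}(K)`
  have hrat : ∀ X : blockNilpotent n k (AdeleRing (𝓞 K) K), X ∈ rationalBlock n k K →
      T X ∈ rationalBlock n (n - k) K := fun X hX i j => by
    obtain ⟨x, hx⟩ := hX j.rev i.rev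
    exact ⟨-x, by rw [map_neg, hx]; rfl⟩
  have hrat' : ∀ Y : blockNilpotent n (n - k) (AdeleRing (𝓞 K) K), Y ∈ rationalBlock n (n - k) K →
      T.symm Y ∈ rationalBlock n k K := fun Y hY i j => by
    obtain ⟨y, hy⟩ := hY j.rev i.rev
    exact ⟨-y, by rw [map_neg, hy]; rfl⟩
  let e : rationalBlock n (n - k) K ≃ rationalBlock n k K :=
    { toFun := fun γ => ⟨T.symm γ, hrat' _ γ.2⟩
      invFun := fun γ => ⟨T γ, hrat _ γ.2⟩
      left_inv := fun γ => Subtype.ext (T.apply_symm_apply _)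
      right_inv := fun γ => Subtype.ext (T.symm_apply_apply _) }
  -- `T 𝓕` is a fundamental domain for the push-forward measure
  have h𝓕' : IsAddFundamentalDomain (rationalBlock n (n - k) K) (Tm '' 𝓕) (Measure.map Tm ν) := by
    refine h𝓕.image_of_equiv Tm.toEquiv ?_ e fun γ X => ?_
    · change Measure.QuasiMeasurePreserving Tm.symm (Measure.map Tm ν) ν
      refine ⟨Tm.symm.measurable, ?_⟩
      rw [Measure.map_map Tm.symm.measurable Tm.measurable, MeasurableEquiv.symm_comp_self, Measure.map_id]
    · change Tm ((e γ : blockNilpotent n k (AdeleRing (𝓞 K) K)) + X) =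
        (γ : blockNilpotent n (n - k) (AdeleRing (𝓞 K) K)) + Tm X
      rw [hTm, hTm, map_add]
      change T (T.symm _) + T X = _
      rw [T.apply_symm_apply]
  -- the integrand after `τ`
  set g' : (AdelicGroupData.gl n K).Adelic := τ𝔸[g] with hg'
  have hint : ∀ X : blockNilpotent n k (AdeleRing (𝓞 K) K),
      (τ𝔸⋆ φ) (glUnipotent n k K (Multiplicative.ofAdd X) * g) =
        φ (glUnipotent n (n - k) K (Multiplicative.ofAdd (Tm X)) * g') := by
    intro X
    rw [LinearMap.funLeft_apply, weylLong_mul_glTransposeInv_mul_weylLong_mul_adelic,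
      weylLong_mul_glTransposeInv_mul_weylLong_glUnipotent, hTm]
    rfl
  obtain ⟨hi, h0⟩ := hφ (Measure.map Tm ν) (Tm '' 𝓕) h𝓕' g'
  simp_rw [hint]
  refine ⟨(hpres.integrableOn_image Tm.measurableEmbedding).mp hi, ?_⟩
  have h1 := setIntegral_map_equiv (μ := ν) Tm
    (fun Y => φ (glUnipotent n (n - k) K (Multiplicative.ofAdd Y) * g')) (Tm '' 𝓕)
  rw [h0, Tm.preimage_image] at h1
  exact h1.symm

/-- **`φ ∘ τ` is a cusp form for every cusp form `φ`** on `GL_n(𝔸_K)` (an automorphic form whose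
constant terms along all `P_k`, `0 < k < n`, vanish: those of `φ` along `P_{n-k}` do).
Borel–Jacquet 1979, 4.4; Cogdell 2004, §2. [folklore] -/
theorem IsCuspFormGL.funLeft_weylLong_mul_glTransposeInv_mul_weylLong
    {φ : (AdelicGroupData.gl n K).Adelic → ℂ} (hφ : IsCuspFormGL n K hcpt φ) :
    IsCuspFormGL n K hcpt (τ𝔸⋆ φ) :=
  ⟨hφ.1.funLeft_weylLong_mul_glTransposeInv_mul_weylLong, fun k hk hkn =>
    (hφ.2 (n - k) (by omega) (by omega)).funLeft_weylLong_mul_glTransposeInv_mul_weylLong⟩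

/-- The space of cusp forms `𝒜₀` on `GL_n(𝔸_K)` is stable under `φ ↦ φ ∘ τ`. [folklore] -/
theorem map_funLeft_weylLong_mul_glTransposeInv_mul_weylLong_cuspFormsGL_le :
    (cuspFormsGL n K hcpt).map τ𝔸⋆ ≤ cuspFormsGL n K hcpt := by
  rw [cuspFormsGL, Submodule.map_span, Submodule.span_le]
  rintro _ ⟨φ, hφ, rfl⟩
  exact (IsCuspFormGL.funLeft_weylLong_mul_glTransposeInv_mul_weylLong hφ).mem_cuspFormsGL

end Cusp

end Literature.NumberTheory.Automorphic
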